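import Summits.AtomisticToContinuum.Crystallization.Theorems.LoopTunnelDialDepthSep
import Summits.AtomisticToContinuum.Crystallization.Theorems.ChessboardParticlePlanesLjLaminarWindowsEarnshaw

/-!
# LoopTunnelDial — THIN ⟺ TOUCH ∧ TENUOUS modulo Earnshaw connectivity (lens-5 generation 18; crux `PocketCase`, stmt-AtomisticToContinuum-27294)

Landing kit file 5/5 (land after file 1).  The residual THIN `ThinCertified s` anatomised: TOUCH (far matter touching non-far matter within
`(11/5)^{1/6} < 1.141`, hence within `7.141` of a CERTIFIED particle) and TENUOUS (ALL-FAR everywhere-`s`-sparse ground states); the detached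
world is empty by the landed Earnshaw connectivity `LjLaminarWindowsSketch.stub_earnshawConnectivity`, taken BY NAME as the hypothesis
`EarnshawConnected` (its module is outside the hub's build closure on 2026-08-30).  All `[folklore]`; 0 sorry.
-/

noncomputable section

open scoped BigOperators Classical InnerProductSpace
open Literature.MathematicalPhysics.StatisticalMechanics
open Literature.MathematicalPhysics.StatisticalMechanics.Yuhjtman2015 (hLJ)
open Summit.AtomisticToContinuum.Crystallization.Theorems.GrainPercolationDialCrossCeiling (E3 ballChunk)
open Summit.AtomisticToContinuum.Crystallization.Theorems.ChargedEnergyGapNegative (eStar)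
open Summit.AtomisticToContinuum.Crystallization.Theorems.LjLaminarWindowsSketch
  (lennardJones_groundState_dist_ge_seven_tenths forceBalance_sum_deriv_eq_zero forceBalance_one_le_sum_hLJ hLJ' kF)
open Summit.AtomisticToContinuum.Crystallization.Theorems.LoopTunnelDialLocalSurgery (improvable_mono)
open Summit.AtomisticToContinuum.Crystallization.Theorems.LoopTunnelDialSieveCurrency
open Summit.AtomisticToContinuum.Crystallization.Theorems.LoopTunnelDialDepthSep

namespace Summit.AtomisticToContinuum.Crystallization.Theorems.LoopTunnelDialThinAnatomy

variable {N : ℕ}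


/-- **`EarnshawConnected`** — VERBATIM the statement of the tree's LANDED, sorry-free theorem
`LjLaminarWindowsSketch.stub_earnshawConnectivity` (`Theorems/ChessboardParticlePlanesLjLaminarWindowsEarnshaw.lean`; Earnshaw / second
variation: `V_LJ` is strictly superharmonic beyond `(11/5)^{1/6} ≈ 1.1404`, so a far-separated group could be rigidly translated to lower the
energy): in a Lennard-Jones ground state in `ℝ³` every non-empty group of particles with non-empty complement has a member within `(11/5)^{1/6}`
of a non-member.  Entered BY NAME as a hypothesis because the module is outside the hub's built closure on 2026-08-30 (`lean check`:
remote:stale:unbuilt); `discharge18.lean` derives it in one line (`:= stub_earnshawConnectivity`). [COSTUME(cite) — a landed theorem, not a piece] [line vocabulary · LoopTunnelDial contact dial · crux stmt-AtomisticToContinuum-27294 · definition, not a cited fact] -/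
def EarnshawConnected : Prop :=
  ∀ (N : ℕ) (x : Fin N → EuclideanSpace ℝ (Fin 3)), IsGroundState lennardJones x →
    ∀ S : Finset (Fin N), S.Nonempty → Sᶜ.Nonempty → ∃ p ∈ S, ∃ k ∈ Sᶜ, dist (x p) (x k) ^ 6 ≤ 11 / 5

/-- `Touching y` — some `(2, 3/50, 6)`-FAR particle lies within `(11/5)^{1/6} (< 1.141)` of a NON-far particle: far matter IN CONTACT. [line vocabulary · LoopTunnelDial contact dial · crux stmt-AtomisticToContinuum-27294 · definition, not a cited fact] -/
def Touching {N : ℕ} (y : Fin N → E3) : Prop :=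
  ∃ a b : Fin N, a ∈ farSet 2 (3 / 50) 6 y ∧ b ∉ farSet 2 (3 / 50) 6 y ∧ dist (y a) (y b) ^ 6 ≤ 11 / 5

/-- `AllFar y` — EVERY particle is far; equivalently there is NO `(2, 3/50)`-certified particle (`allFar_iff_certSet_eq_empty`). [line vocabulary · LoopTunnelDial contact dial · crux stmt-AtomisticToContinuum-27294 · definition, not a cited fact] -/
def AllFar {N : ℕ} (y : Fin N → E3) : Prop := ∀ i : Fin N, i ∈ farSet 2 (3 / 50) 6 y

/-- `Sparse s y` — every particle's `s`-ball holds fewer than `s³` particles (filling `< 24 %` at `7/10`-separation's maximum). [line vocabulary · LoopTunnelDial contact dial · crux stmt-AtomisticToContinuum-27294 · definition, not a cited fact] -/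
def Sparse (s : ℝ) {N : ℕ} (y : Fin N → E3) : Prop := ∀ i : Fin N, ((ballChunk y i s).card : ℝ) < s ^ 3

/-- ALL-FAR iff no particle is certified. [folklore] -/
theorem allFar_iff_certSet_eq_empty {y : Fin N → E3} : AllFar y ↔ certSet 2 (3 / 50) y = ∅ := by
  constructor
  · intro h
    rw [Finset.eq_empty_iff_forall_notMem]
    intro j hj
    have hj' := h j
    rw [farSet, Finset.mem_filter] at hj'
    have := hj'.2 j hj
    rw [dist_self] at this
    linarith
  · intro h i
    rw [farSet, Finset.mem_filter]
    refine ⟨Finset.mem_univ _, fun j hj => ?_⟩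
    rw [h] at hj
    simp at hj

/-- **THE DICHOTOMY (PROVED modulo `EarnshawConnected`).** A ground state with a far particle is TOUCHING or ALL-FAR — the detached world is empty. -/
theorem touching_or_allFar (hE : EarnshawConnected) {y : Fin N → E3} (hy : IsGroundState lennardJones y)
    (hfar : ∃ i : Fin N, i ∈ farSet 2 (3 / 50) 6 y) : Touching y ∨ AllFar y := by
  by_cases hall : AllFar y
  · exact Or.inr hall
  · left
    unfold AllFar at hall
    push Not at hall
    obtain ⟨b, hb⟩ := hall
    obtain ⟨i, hi⟩ := hfar
    obtain ⟨p, hp, k, hk, hd⟩ := hE N y hy (farSet 2 (3 / 50) 6 y) ⟨i, hi⟩ ⟨b, Finset.mem_compl.2 hb⟩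
    exact ⟨p, k, hp, Finset.mem_compl.1 hk, hd⟩

/-- THE CONTACT SHELL (PROVED reading of TOUCH's world): a touching far particle has a CERTIFIED particle at distance in `(6, 7.141)`. -/
theorem exists_cert_near_of_touching {y : Fin N → E3} (h : Touching y) :
    ∃ a j : Fin N, a ∈ farSet 2 (3 / 50) 6 y ∧ j ∈ certSet 2 (3 / 50) y ∧ 6 < dist (y a) (y j) ∧ dist (y a) (y j) < 7141 / 1000 := by
  obtain ⟨a, b, ha, hb, hd⟩ := h
  have ha' := ha
  rw [farSet, Finset.mem_filter] at ha' hb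
  push Not at hb
  obtain ⟨j, hj, hbj⟩ := hb (Finset.mem_univ _)
  refine ⟨a, j, ha, hj, ha'.2 j hj, ?_⟩
  have hab := Summit.AtomisticToContinuum.Crystallization.Theorems.LjLaminarWindowsSketch.earnshaw_dist_lt_of_pow_six_le hd
  calc dist (y a) (y j) ≤ dist (y a) (y b) + dist (y b) (y j) := dist_triangle _ _ _
    _ < 1141 / 1000 + 6 := by linarith
    _ = 7141 / 1000 := by norm_num

/-- **TOUCH** — the door restricted to ground states with `s`-SHALLOW far matter IN CONTACT with non-far matter.  [DECLARED RESIDUAL ·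
WEAKER than THIN (`touchCertified_of_thinCertified`, a restriction) · the interface world: intergranular films, junction filaments, pocket and
cavity LININGS hugging certified matter at distance `< 7.141`; compact pieces certificate-attackable like NEAR♯; BARRIER-core
(TetrahedralFrustration) bites only through interface matter.] [line vocabulary · LoopTunnelDial contact dial · crux stmt-AtomisticToContinuum-27294 · definition, not a cited fact] -/
def TouchCertificate (s : ℝ) (N₀ : ℕ) (s₀ g : ℝ) : Prop :=
  ∀ N : ℕ, N₀ ≤ N → ∀ y : Fin N → E3, IsGroundState lennardJones y → ShallowFar s y → Touching y →
    ∃ c : Fin N, Improvable eStar g s₀ y c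

/-- `TouchCertified s` — some valid TOUCH certificate. [typed sub-piece of PREVIEW STUB 4] [line vocabulary · LoopTunnelDial contact dial · crux stmt-AtomisticToContinuum-27294 · definition, not a cited fact] -/
def TouchCertified (s : ℝ) : Prop := ∃ N₀ : ℕ, ∃ s₀ g : ℝ, 0 ≤ s₀ ∧ 0 < g ∧ TouchCertificate s N₀ s₀ g

/-- **TENUOUS** — the door restricted to non-empty ground states with NO certified particle at all (all far), everywhere `s`-SPARSE.
[DECLARED RESIDUAL · WEAKER than THIN (`tenuousCertified_of_thinCertified`) · BARRIER: its least instance is a whole ground state that is an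
everywhere-loose foam below `24 %` filling at scale `s` — excluding it needs a far-matter energy EXCESS or a lower bound on `e⋆`, the barrier core
(lens-4's cavity world); for `N < s³` it contains every all-far cluster ground state (icosahedral / decahedral windows), which the certificate
must improve at chemical potential `e⋆` — true for clusters (surface particles have `𝓔 ≥ e⋆ + g`) but GS-knowledge-dependent.] [line vocabulary · LoopTunnelDial contact dial · crux stmt-AtomisticToContinuum-27294 · definition, not a cited fact] -/
def TenuousCertificate (s : ℝ) (N₀ : ℕ) (s₀ g : ℝ) : Prop :=
  ∀ N : ℕ, N₀ ≤ N → 0 < N → ∀ y : Fin N → E3, IsGroundState lennardJones y → AllFar y → Sparse s y →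
    ∃ c : Fin N, Improvable eStar g s₀ y c

/-- `TenuousCertified s` — some valid TENUOUS certificate. [typed sub-piece of PREVIEW STUB 4] [line vocabulary · LoopTunnelDial contact dial · crux stmt-AtomisticToContinuum-27294 · definition, not a cited fact] -/
def TenuousCertified (s : ℝ) : Prop := ∃ N₀ : ℕ, ∃ s₀ g : ℝ, 0 ≤ s₀ ∧ 0 < g ∧ TenuousCertificate s N₀ s₀ g

/-- Shallow ∧ all-far ⟹ sparse. -/
theorem sparse_of_shallowFar_allFar {s : ℝ} {y : Fin N → E3} (hsh : ShallowFar s y) (hall : AllFar y) : Sparse s y := by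
  intro i
  rcases not_deepFar_iff.1 (hsh i (hall i)) with ⟨k, _, hk⟩ | h
  · exact absurd (hall k) hk
  · exact h

/-- Sparse ⟹ shallow. -/
theorem shallowFar_of_sparse {s : ℝ} {y : Fin N → E3} (h : Sparse s y) : ShallowFar s y :=
  fun i _ => not_deepFar_iff.2 (Or.inr (h i))

/-- THIN ⟹ TOUCH (PROVED: a restriction). -/
theorem touchCertified_of_thinCertified {s : ℝ} (h : ThinCertified s) : TouchCertified s := by
  obtain ⟨N₀, s₀, g, hs₀, hg, h⟩ := h
  exact ⟨N₀, s₀, g, hs₀, hg, fun N hN y hy hsh ht => by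
    obtain ⟨a, b, ha, _, _⟩ := ht
    exact h N hN y hy hsh ⟨a, ha⟩⟩

/-- THIN ⟹ TENUOUS (PROVED: a restriction). -/
theorem tenuousCertified_of_thinCertified {s : ℝ} (h : ThinCertified s) : TenuousCertified s := by
  obtain ⟨N₀, s₀, g, hs₀, hg, h⟩ := h
  exact ⟨N₀, s₀, g, hs₀, hg, fun N hN hpos y hy hall hsp =>
    h N hN y hy (shallowFar_of_sparse hsp) ⟨⟨0, hpos⟩, hall _⟩⟩

/-- **THIN ⟸ TOUCH ∧ TENUOUS (PROVED modulo `EarnshawConnected`).** -/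
theorem thinCertified_of_touch_tenuous (hE : EarnshawConnected) {s : ℝ} (hT : TouchCertified s) (hU : TenuousCertified s) :
    ThinCertified s := by
  obtain ⟨N₁, s₁, g₁, hs₁, hg₁, hT⟩ := hT
  obtain ⟨N₂, s₂, g₂, hs₂, hg₂, hU⟩ := hU
  refine ⟨max N₁ N₂, max s₁ s₂, min g₁ g₂, le_max_of_le_left hs₁, lt_min hg₁ hg₂, fun N hN y hy hsh hfar => ?_⟩
  rcases touching_or_allFar hE hy hfar with ht | hall
  · obtain ⟨c, hc⟩ := hT N ((le_max_left _ _).trans hN) y hy hsh ht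
    exact ⟨c, improvable_weaken (min_le_left _ _) (le_max_left _ _) hs₁ hc⟩
  · obtain ⟨i, _⟩ := hfar
    obtain ⟨c, hc⟩ := hU N ((le_max_right _ _).trans hN) (lt_of_le_of_lt (Nat.zero_le _) i.isLt) y hy hall
      (sparse_of_shallowFar_allFar hsh hall)
    exact ⟨c, improvable_weaken (min_le_right _ _) (le_max_right _ _) hs₂ hc⟩

/-- **THIN ⟺ TOUCH ∧ TENUOUS (PROVED EQUIVALENCE modulo `EarnshawConnected`).** -/
theorem thinCertified_iff_touch_tenuous (hE : EarnshawConnected) {s : ℝ} :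
    ThinCertified s ↔ TouchCertified s ∧ TenuousCertified s :=
  ⟨fun h => ⟨touchCertified_of_thinCertified h, tenuousCertified_of_thinCertified h⟩,
    fun h => thinCertified_of_touch_tenuous hE h.1 h.2⟩

end Summit.AtomisticToContinuum.Crystallization.Theorems.LoopTunnelDialThinAnatomy

end
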